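import Literature.Topology.FourManifolds.BandSumUnitLoops
import HarnessLib

/-!
# The unknot is a unit for the connected sum, IV: tying the mushroom into the knot

Topic `Literature/Topology/FourManifolds`; fourth file of the discharge of
`Literature.Topology.FourManifolds.Knot.exists_isConnectedSum_unknot_isIsotopic` (`BandSum.lean`;
Rolfsen (1976), §2.G). For a flat-arc configuration `C` the mushroom family
`mush λ τ` (`BandSumUnitProfiles.lean`) is inserted into the knot `C.K` along its flat arc:

* `FlatArcConfig.newChart τ θ = chartCurve θ + ρ θ • planeLin (mush λ τ (σ θ) - (σ θ, 0))` — the chart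
  curve of `K` displaced along the arc plane, with a plateau cut-off `ρ` in the knot parameter;
  on the arc window `[α, β]` it is `planeMap (mush λ τ (σ θ))` (`newChart_of_mem`), off `(α, β)` it is
  the chart curve (`newChart_of_not_mem`), and `newChart 0 = chartCurve`; it is regular
  (`deriv_newChart_ne_zero`).
* `FlatArcConfig.newLoop τ`, `FlatArcConfig.baseLoop` — the corresponding loops of period one on
  `𝕊³` (through `ψ⁻¹`); the hypotheses of `IsRegularLoop.isIsotopic_of_modification`
  (`CurveFamilyIsotopy.lean`) are verified: smoothness, agreement off the window, regularity,
  injectivity on the window (`mush_injective` and the monotonicity of `σ`), and disjointness of the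
  displaced arc from the rest of the knot (the clean box of the flat arc).
* `FlatArcConfig.newKnot` — **the band sum `K # O` as a knot**, the knot of `newLoop 1`, with
  `newKnot (cos θ, sin θ) = toSphere (mush λ 1 (σ θ))` on the window and `newKnot x = K x` off it
  (`newKnot_circlePoint_of_mem`, `newKnot_eq_or`, `mem_range_newKnot_iff`);
* `FlatArcConfig.isIsotopic_newKnot : C.K ≃ newKnot` — by the isotopy extension theorem applied to
  the smooth family of simple regular loops `newLoop τ`, `τ ∈ [0, 1]`.

## References

* D. Rolfsen, *Knots and Links* (1976), §2.G. [Rolfsen1976]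
* M. W. Hirsch, *Differential Topology* (1976), Ch. 8 §1, Thm. 1.3. [HirschDT1976]
* R. H. Crowell, R. H. Fox, *Introduction to Knot Theory* (1963), Ch. I §2. [CrowellFox1963]

## Design notes

All statements are `[folklore]` except the two isotopy statements; no named facts, no `sorry`.
-/

open scoped Manifold ContDiff Topology RealInnerProductSpace Real
open Function Set Metric Module Real

noncomputable section

namespace Literature.Topology.FourManifolds

/-- Local notation: `𝔼 n` is the model Euclidean space `EuclideanSpace ℝ (Fin n)`. -/
local notation "𝔼 " n:arg => EuclideanSpace ℝ (Fin n)

/-- Local notation: `𝕊 n` is the unit sphere in `EuclideanSpace ℝ (Fin (n + 1))`. -/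
local notation "𝕊 " n:arg => (Metric.sphere (0 : EuclideanSpace ℝ (Fin (n + 1))) 1)

attribute [local instance] fact_finrank_euclideanSpace_succ

namespace BandSumUnit

open KnotsInBall

/-- Two parameters of the same fundamental domain `[a, a + 1)` differing by an integer are equal.
[folklore] -/
theorem eq_of_mem_Ico_of_sub_eq_int {a s t : ℝ} (hs : s ∈ Ico a (a + 1)) (ht : t ∈ Ico a (a + 1))
    {k : ℤ} (h : t - s = k) : t = s := by
  have h1 : (k : ℝ) < 1 := by rw [← h]; linarith [hs.1, ht.2]
  have h2 : (-1 : ℝ) < k := by rw [← h]; linarith [hs.2, ht.1]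
  have : k = 0 := by
    have a1 : k < 1 := by exact_mod_cast h1
    have a2 : -1 < k := by exact_mod_cast h2
    omega
  rw [this] at h; simp at h; linarith

/-- Two reals whose circle points agree after scaling by `2π` differ by an integer. [folklore] -/
theorem exists_sub_eq_int_of_circlePoint_eq {s t : ℝ}
    (h : circlePoint (2 * π * s) = circlePoint (2 * π * t)) : ∃ k : ℤ, t - s = k := by
  obtain ⟨k, hk⟩ := exists_eq_add_of_circlePoint_eq h
  refine ⟨-k, ?_⟩
  have : 2 * π * (t - s) = 2 * π * (-k) := by nlinarith [hk]
  have := mul_left_cancel₀ (by positivity : (2 * π : ℝ) ≠ 0) this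
  push_cast at this ⊢; linarith

namespace FlatArcConfig

variable (C : FlatArcConfig)

/-! ### The plateau cut-off in the knot parameter -/

/-- `-ℓ/2 ∈ [-ℓ, ℓ]`. [folklore] -/
theorem neg_half_mem : -(C.ℓ / 2) ∈ Icc (-C.ℓ) C.ℓ := ⟨by linarith [C.ℓ_pos], by linarith [C.ℓ_pos]⟩

/-- `ℓ/2 ∈ [-ℓ, ℓ]`. [folklore] -/
theorem half_mem : C.ℓ / 2 ∈ Icc (-C.ℓ) C.ℓ := ⟨by linarith [C.ℓ_pos], by linarith [C.ℓ_pos]⟩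

/-- Start of the plateau: the parameter with tangent coordinate `-ℓ/2`. [folklore] -/
def θlo : ℝ := C.θOf (-(C.ℓ / 2))

/-- End of the plateau: the parameter with tangent coordinate `ℓ/2`. [folklore] -/
def θhi : ℝ := C.θOf (C.ℓ / 2)

/-- `σ θlo = -ℓ/2`. [folklore] -/
@[simp] theorem σ_θlo : C.σ C.θlo = -(C.ℓ / 2) := C.σ_θOf C.neg_half_mem

/-- `σ θhi = ℓ/2`. [folklore] -/
@[simp] theorem σ_θhi : C.σ C.θhi = C.ℓ / 2 := C.σ_θOf C.half_mem

/-- `θlo` lies in the window. [folklore] -/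
theorem θlo_mem : C.θlo ∈ Icc C.α C.β := C.θOf_mem C.neg_half_mem

/-- `θhi` lies in the window. [folklore] -/
theorem θhi_mem : C.θhi ∈ Icc C.α C.β := C.θOf_mem C.half_mem

/-- `α < θlo`. [folklore] -/
theorem α_lt_θlo : C.α < C.θlo := by
  have h : C.θOf (-C.ℓ) < C.θOf (-(C.ℓ / 2)) :=
    C.θOf_lt_θOf ⟨le_rfl, by linarith [C.ℓ_pos]⟩ C.neg_half_mem (by linarith [C.ℓ_pos])
  have e : C.θOf (-C.ℓ) = C.α := by rw [← C.σ_α]; exact C.θOf_σ (left_mem_Icc.2 C.α_lt_β.le)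
  rw [e] at h; exact h

/-- `θlo < θhi`. [folklore] -/
theorem θlo_lt_θhi : C.θlo < C.θhi :=
  C.θOf_lt_θOf C.neg_half_mem C.half_mem (by linarith [C.ℓ_pos])

/-- `θhi < β`. [folklore] -/
theorem θhi_lt_β : C.θhi < C.β := by
  have h : C.θOf (C.ℓ / 2) < C.θOf C.ℓ :=
    C.θOf_lt_θOf C.half_mem ⟨by linarith [C.ℓ_pos], le_rfl⟩ (by linarith [C.ℓ_pos])
  have e : C.θOf C.ℓ = C.β := by rw [← C.σ_β]; exact C.θOf_σ (right_mem_Icc.2 C.α_lt_β.le)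
  rw [e] at h; exact h

/-- **The plateau cut-off** `ρ`: `1` on `[θlo, θhi]`, `0` off `(α, β)`. [folklore] -/
def rho (θ : ℝ) : ℝ := smoothStep C.α C.θlo θ * (1 - smoothStep C.θhi C.β θ)

/-- `ρ` is `C^∞`. [folklore] -/
theorem contDiff_rho : ContDiff ℝ ∞ C.rho :=
  (contDiff_smoothStep _ _).mul (contDiff_const.sub (contDiff_smoothStep _ _))

/-- `ρ θ = 0` for `θ ≤ α`. [folklore] -/
theorem rho_of_le_α {θ : ℝ} (h : θ ≤ C.α) : C.rho θ = 0 := by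
  rw [rho, smoothStep_of_le C.α_lt_θlo h, zero_mul]

/-- `ρ θ = 0` for `β ≤ θ`. [folklore] -/
theorem rho_of_β_le {θ : ℝ} (h : C.β ≤ θ) : C.rho θ = 0 := by
  rw [rho, smoothStep_of_ge C.θhi_lt_β h]; ring

/-- `ρ θ = 0` off `(α, β)`. [folklore] -/
theorem rho_of_not_mem {θ : ℝ} (h : θ ∉ Ioo C.α C.β) : C.rho θ = 0 := by
  rcases le_or_gt θ C.α with h1 | h1
  · exact C.rho_of_le_α h1
  · exact C.rho_of_β_le (le_of_not_gt fun h2 ↦ h ⟨h1, h2⟩)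

/-- `ρ θ = 1` on `[θlo, θhi]`. [folklore] -/
theorem rho_of_mem {θ : ℝ} (h : θ ∈ Icc C.θlo C.θhi) : C.rho θ = 1 := by
  rw [rho, smoothStep_of_ge C.α_lt_θlo h.1, smoothStep_of_le C.θhi_lt_β h.2]; ring

/-- A window parameter with `|σ θ| < ℓ/2` lies in the plateau `(θlo, θhi)`. [folklore] -/
theorem mem_Ioo_of_abs_σ_lt {θ : ℝ} (hθ : θ ∈ Icc C.α C.β) (h : |C.σ θ| < C.ℓ / 2) :
    θ ∈ Ioo C.θlo C.θhi := by
  have h' := abs_lt.1 h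
  constructor
  · by_contra hle; push Not at hle
    have := C.strictMonoOn_σ.monotoneOn hθ C.θlo_mem hle
    rw [σ_θlo] at this; linarith
  · by_contra hle; push Not at hle
    have := C.strictMonoOn_σ.monotoneOn C.θhi_mem hθ hle
    rw [σ_θhi] at this; linarith

/-- The plateau lies in the open window. [folklore] -/
theorem Ioo_θ_subset : Ioo C.θlo C.θhi ⊆ Ioo C.α C.β := fun _ h ↦
  ⟨C.α_lt_θlo.trans h.1, h.2.trans C.θhi_lt_β⟩

/-! ### The displaced chart curve -/

/-- **The displaced chart curve**: the chart curve of `K` plus, on the plateau, the planar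
displacement of the mushroom stage `τ` at the tangent coordinate `σ θ`. [folklore] -/
def newChart (τ θ : ℝ) : 𝔼 3 :=
  C.K.chartCurve θ + C.rho θ • C.planeLin (mush C.lam τ (C.σ θ) - pt2 (C.σ θ) 0)

/-- The mushroom does not move points with `|u| ≥ 3λ/4`. [folklore] -/
theorem mush_sub_eq_zero {u : ℝ} (τ : ℝ) (hu : 3 * C.lam / 4 ≤ |u|) :
    mush C.lam τ u - pt2 u 0 = 0 := by
  rw [mush_of_le_abs C.lam_pos τ hu, sub_self]

/-- `3λ/4 < ℓ/2`. [folklore] -/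
theorem three_quarters_lam_lt : 3 * C.lam / 4 < C.ℓ / 2 := by linarith [C.lam_le_half_ℓ, C.lam_pos]

/-- Off `(α, β)` the displaced chart curve is the chart curve. [folklore] -/
theorem newChart_of_not_mem (τ : ℝ) {θ : ℝ} (h : θ ∉ Ioo C.α C.β) :
    C.newChart τ θ = C.K.chartCurve θ := by
  rw [newChart, C.rho_of_not_mem h, zero_smul, add_zero]

/-- **On the window the displaced chart curve is the planar mushroom stage**:
`newChart τ θ = planeMap (mush λ τ (σ θ))` for `θ ∈ [α, β]`. [folklore] -/
theorem newChart_of_mem (τ : ℝ) {θ : ℝ} (hθ : θ ∈ Icc C.α C.β) :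
    C.newChart τ θ = C.planeMap (mush C.lam τ (C.σ θ)) := by
  rw [newChart, C.chartCurve_eq_planeMap hθ]
  by_cases h : 3 * C.lam / 4 ≤ |C.σ θ|
  · rw [mush_of_le_abs C.lam_pos τ h, sub_self, map_zero, smul_zero, add_zero]
  · push Not at h
    rw [C.rho_of_mem (Ioo_subset_Icc_self (C.mem_Ioo_of_abs_σ_lt hθ (h.trans C.three_quarters_lam_lt))),
      one_smul, planeMap_eq, planeMap_eq, map_sub]
    abel

/-- At `τ = 0` nothing is displaced. [folklore] -/
theorem newChart_zero (θ : ℝ) : C.newChart 0 θ = C.K.chartCurve θ := by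
  rw [newChart, mush_zero, sub_self, map_zero, smul_zero, add_zero]

/-- The displaced chart curve is jointly `C^∞`. [folklore] -/
theorem contDiff_newChart : ContDiff ℝ ∞ (uncurry C.newChart) := by
  have hc : ContDiff ℝ ∞ fun p : ℝ × ℝ ↦ C.K.chartCurve p.2 :=
    (Knot.contDiff_chartCurve C.ne_southPole).comp contDiff_snd
  have hρ : ContDiff ℝ ∞ fun p : ℝ × ℝ ↦ C.rho p.2 := C.contDiff_rho.comp contDiff_snd
  have hσ : ContDiff ℝ ∞ fun p : ℝ × ℝ ↦ C.σ p.2 := C.contDiff_σ.comp contDiff_snd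
  have hm : ContDiff ℝ ∞ fun p : ℝ × ℝ ↦ mush C.lam p.1 (C.σ p.2) :=
    (contDiff_mush C.lam).comp (contDiff_fst.prodMk hσ)
  have hp : ContDiff ℝ ∞ fun p : ℝ × ℝ ↦ pt2 (C.σ p.2) 0 := contDiff_pt2 hσ contDiff_const
  have : uncurry C.newChart = fun p : ℝ × ℝ ↦
      C.K.chartCurve p.2 + C.rho p.2 • C.planeLin (mush C.lam p.1 (C.σ p.2) - pt2 (C.σ p.2) 0) := rfl
  rw [this]
  exact hc.add (hρ.smul (C.planeLin.contDiff.comp (hm.sub hp)))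

/-- Each stage of the displaced chart curve is `C^∞`. [folklore] -/
theorem contDiff_newChart_stage (τ : ℝ) : ContDiff ℝ ∞ (C.newChart τ) := by
  have : C.newChart τ = uncurry C.newChart ∘ fun θ ↦ (τ, θ) := rfl
  rw [this]; exact C.contDiff_newChart.comp (contDiff_const.prodMk contDiff_id)

/-! #### Local forms and regularity -/

/-- Near a window parameter with `|σ θ| > 3λ/4`, and near every parameter outside `[α, β]`, the
displaced chart curve is the chart curve. [folklore] -/
theorem newChart_eventuallyEq_chartCurve (τ : ℝ) {θ : ℝ}
    (h : θ ∉ Icc C.α C.β ∨ 3 * C.lam / 4 < |C.σ θ|) :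
    C.newChart τ =ᶠ[𝓝 θ] C.K.chartCurve := by
  have hV : IsOpen ((Icc C.α C.β)ᶜ ∪ {θ | 3 * C.lam / 4 < |C.σ θ|}) :=
    isClosed_Icc.isOpen_compl.union (isOpen_lt continuous_const (continuous_abs.comp C.continuous_σ))
  have hθ : θ ∈ (Icc C.α C.β)ᶜ ∪ {θ | 3 * C.lam / 4 < |C.σ θ|} := by
    rcases h with h | h
    · exact Or.inl h
    · exact Or.inr h
  filter_upwards [hV.mem_nhds hθ] with θ' hθ'
  by_cases hm : θ' ∈ Icc C.α C.β
  · rcases hθ' with h1 | h1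
    · exact absurd hm h1
    · rw [C.newChart_of_mem τ hm, mush_of_le_abs C.lam_pos τ (le_of_lt h1), C.chartCurve_eq_planeMap hm]
  · exact C.newChart_of_not_mem τ fun h' ↦ hm (Ioo_subset_Icc_self h')

/-- Near a plateau parameter the displaced chart curve is `planeMap ∘ mush λ τ ∘ σ`. [folklore] -/
theorem newChart_eventuallyEq_planeMap (τ : ℝ) {θ : ℝ} (h : θ ∈ Ioo C.θlo C.θhi) :
    C.newChart τ =ᶠ[𝓝 θ] fun θ' ↦ C.planeMap (mush C.lam τ (C.σ θ')) := by
  filter_upwards [Ioo_mem_nhds h.1 h.2] with θ' hθ'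
  exact C.newChart_of_mem τ (Ioo_subset_Icc_self (C.Ioo_θ_subset hθ'))

/-- **The displaced chart curve is regular.** [folklore] -/
theorem deriv_newChart_ne_zero (τ θ : ℝ) : deriv (C.newChart τ) θ ≠ 0 := by
  by_cases h : θ ∈ Icc C.α C.β ∧ |C.σ θ| ≤ 3 * C.lam / 4
  · -- plateau: `planeMap ∘ mush ∘ σ`
    have hθ : θ ∈ Ioo C.θlo C.θhi :=
      C.mem_Ioo_of_abs_σ_lt h.1 (h.2.trans_lt C.three_quarters_lam_lt)
    rw [(C.newChart_eventuallyEq_planeMap τ hθ).deriv_eq]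
    have hσd : HasDerivAt C.σ (deriv C.σ θ) θ := (C.differentiable_σ θ).hasDerivAt
    have hmd : HasDerivAt (mush C.lam τ) (deriv (mush C.lam τ) (C.σ θ)) (C.σ θ) :=
      (((contDiff_mush_stage C.lam τ).differentiable (by simp)) _).hasDerivAt
    have hcomp : HasDerivAt (fun θ' ↦ mush C.lam τ (C.σ θ')) (deriv C.σ θ • deriv (mush C.lam τ) (C.σ θ)) θ :=
      hmd.scomp θ hσd
    have hfull : HasDerivAt (fun θ' ↦ C.planeMap (mush C.lam τ (C.σ θ')))
        (C.planeLin (deriv C.σ θ • deriv (mush C.lam τ) (C.σ θ))) θ :=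
      (C.hasFDerivAt_planeMap _).comp_hasDerivAt θ hcomp
    rw [hfull.deriv]
    intro h0
    have h1 : deriv C.σ θ • deriv (mush C.lam τ) (C.σ θ) = 0 :=
      C.planeLin_injective (h0.trans (map_zero C.planeLin).symm)
    rw [smul_eq_zero] at h1
    rcases h1 with h1 | h1
    · exact (C.deriv_σ_pos θ h.1).ne' h1
    · exact deriv_mush_ne_zero C.lam_pos τ _ h1
  · have h' : θ ∉ Icc C.α C.β ∨ 3 * C.lam / 4 < |C.σ θ| := by
      by_cases h1 : θ ∈ Icc C.α C.β
      · right; exact lt_of_not_ge fun h2 ↦ h ⟨h1, h2⟩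
      · left; exact h1
    rw [(C.newChart_eventuallyEq_chartCurve τ h').deriv_eq]
    exact Knot.deriv_chartCurve_ne_zero C.ne_southPole θ

/-! ### The loops of period one -/

/-- The knot `K` as a loop of period one in `ℝ⁴`. [folklore] -/
def baseLoop (t : ℝ) : 𝔼 4 := SphereEmbedding.curve C.K (2 * π * t)

/-- The displaced loops of period one in `ℝ⁴`. [folklore] -/
def newLoop (τ t : ℝ) : 𝔼 4 := coePsiSymm (C.newChart τ (2 * π * t))

/-- The base loop through the chart. [folklore] -/
theorem baseLoop_eq (t : ℝ) : C.baseLoop t = coePsiSymm (C.K.chartCurve (2 * π * t)) := by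
  rw [baseLoop, Knot.curve_eq_comp_chartCurve C.ne_southPole]; rfl

/-- The base loop is `K` at the circle point. [folklore] -/
theorem baseLoop_apply (t : ℝ) : C.baseLoop t = ((C.K (circlePoint (2 * π * t)) : 𝕊 3) : 𝔼 4) := rfl

/-- The base loop is `1`-periodic. [folklore] -/
theorem periodic_baseLoop : Periodic C.baseLoop 1 := fun t ↦ by
  rw [baseLoop, baseLoop, mul_add, mul_one]
  exact SphereEmbedding.periodic_curve C.K _

/-- The base loop is a regular loop. [folklore] -/
theorem isRegularLoop_baseLoop : IsRegularLoop C.baseLoop where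
  contDiff := (SphereEmbedding.contDiff_curve C.K).comp (contDiff_const.mul contDiff_id)
  periodic := C.periodic_baseLoop
  norm_eq_one t := SphereEmbedding.norm_curve C.K _
  deriv_ne_zero t := by
    show deriv (fun t ↦ SphereEmbedding.curve C.K (2 * π * t)) t ≠ 0
    rw [deriv_comp_mul_left (2 * π) (SphereEmbedding.curve C.K) t]
    exact smul_ne_zero (by positivity) (SphereEmbedding.tangent_ne_zero C.K _)

/-- At `τ = 0` the displaced loop is the base loop. [folklore] -/
theorem newLoop_zero (t : ℝ) : C.newLoop 0 t = C.baseLoop t := by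
  rw [newLoop, newChart_zero, baseLoop_eq]

/-- The family of displaced loops is jointly `C^∞`. [folklore] -/
theorem contDiff_newLoop : ContDiff ℝ ∞ (uncurry C.newLoop) := by
  have : uncurry C.newLoop =
      coePsiSymm ∘ uncurry C.newChart ∘ fun p : ℝ × ℝ ↦ (p.1, 2 * π * p.2) := rfl
  rw [this]
  exact contDiff_coePsiSymm.comp
    (C.contDiff_newChart.comp (contDiff_fst.prodMk (contDiff_const.mul contDiff_snd)))

/-- Each displaced loop is `C^∞`. [folklore] -/
theorem contDiff_newLoop_stage (τ : ℝ) : ContDiff ℝ ∞ (C.newLoop τ) := by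
  have : C.newLoop τ = uncurry C.newLoop ∘ fun t ↦ (τ, t) := rfl
  rw [this]; exact C.contDiff_newLoop.comp (contDiff_const.prodMk contDiff_id)

/-- The displaced loops have unit norm. [folklore] -/
theorem norm_newLoop (τ t : ℝ) : ‖C.newLoop τ t‖ = 1 := norm_coePsiSymm _

/-- **The displaced loops are regular.** [folklore] -/
theorem deriv_newLoop_ne_zero (τ t : ℝ) : deriv (C.newLoop τ) t ≠ 0 := by
  have hd : DifferentiableAt ℝ (C.newChart τ) (2 * π * t) :=
    ((C.contDiff_newChart_stage τ).differentiable (by simp)) _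
  have h1 : deriv (fun t ↦ C.newChart τ (2 * π * t)) t ≠ 0 := by
    rw [deriv_comp_mul_left (2 * π) (C.newChart τ) t]
    exact smul_ne_zero (by positivity) (C.deriv_newChart_ne_zero τ _)
  have hd' : DifferentiableAt ℝ (fun t ↦ C.newChart τ (2 * π * t)) t :=
    hd.comp t ((differentiableAt_id.const_mul _))
  exact deriv_coePsiSymm_comp_ne_zero hd' h1

/-! ### The fundamental domain -/

/-- Start of the window in the period-one parameter. [folklore] -/
def tα : ℝ := C.α / (2 * π)

/-- End of the window in the period-one parameter. [folklore] -/
def tβ : ℝ := C.β / (2 * π)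

/-- Half the slack of the window in the period. [folklore] -/
def ε₀ : ℝ := (1 - (C.tβ - C.tα)) / 2

/-- The seam of the fundamental domain `[a₀, a₀ + 1)`. [folklore] -/
def a₀ : ℝ := C.tβ - 1 + C.ε₀

/-- `2π tα = α`. [folklore] -/
theorem two_pi_mul_tα : 2 * π * C.tα = C.α := by unfold tα; field_simp
/-- `2π tβ = β`. [folklore] -/
theorem two_pi_mul_tβ : 2 * π * C.tβ = C.β := by unfold tβ; field_simp

/-- `tα < tβ`. [folklore] -/
theorem tα_lt_tβ : C.tα < C.tβ := by
  unfold tα tβ; exact div_lt_div_of_pos_right C.α_lt_β (by positivity)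

/-- `tβ - tα < 1`. [folklore] -/
theorem tβ_sub_tα_lt : C.tβ - C.tα < 1 := by
  unfold tα tβ
  rw [← sub_div, div_lt_one (by positivity)]
  linarith [C.β_lt]

/-- `0 < ε₀`. [folklore] -/
theorem ε₀_pos : 0 < C.ε₀ := by unfold ε₀; linarith [C.tβ_sub_tα_lt]

/-- `a₀ + ε₀ = tα`. [folklore] -/
theorem a₀_add_ε₀ : C.a₀ + C.ε₀ = C.tα := by unfold a₀ ε₀; ring

/-- `a₀ + 1 - ε₀ = tβ`. [folklore] -/
theorem a₀_add_one_sub_ε₀ : C.a₀ + 1 - C.ε₀ = C.tβ := by unfold a₀; ring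

/-- The window `S = [tα, tβ]` in the period-one parameter. [folklore] -/
def Spar : Set ℝ := Icc C.tα C.tβ

/-- The window sits inside the fundamental domain with margins `ε₀`. [folklore] -/
theorem Spar_subset : C.Spar ⊆ Icc (C.a₀ + C.ε₀) (C.a₀ + 1 - C.ε₀) := by
  rw [Spar, a₀_add_ε₀, a₀_add_one_sub_ε₀]

/-- The window lies in the fundamental domain. [folklore] -/
theorem Spar_subset_Ico : C.Spar ⊆ Ico C.a₀ (C.a₀ + 1) := fun t ht ↦ by
  have h := C.Spar_subset ht
  exact ⟨by linarith [h.1, C.ε₀_pos], by linarith [h.2, C.ε₀_pos]⟩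

/-- Membership in the window in terms of the angle. [folklore] -/
theorem mem_Spar_iff {t : ℝ} : t ∈ C.Spar ↔ 2 * π * t ∈ Icc C.α C.β := by
  rw [Spar, ← two_pi_mul_tα, ← two_pi_mul_tβ]
  constructor
  · intro h; exact ⟨by nlinarith [h.1, pi_pos], by nlinarith [h.2, pi_pos]⟩
  · intro h; exact ⟨by nlinarith [h.1, pi_pos], by nlinarith [h.2, pi_pos]⟩

/-- A window angle gives a window parameter. [folklore] -/
theorem div_mem_Spar {θ : ℝ} (hθ : θ ∈ Icc C.α C.β) : θ / (2 * π) ∈ C.Spar := by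
  rw [mem_Spar_iff, mul_div_cancel₀ _ (by positivity : (2 * π : ℝ) ≠ 0)]; exact hθ

/-! ### The hypotheses of the modification lemma -/

/-- Off the window the displaced loops are the base loop. [folklore] -/
theorem newLoop_of_not_mem (τ : ℝ) {t : ℝ} (ht : t ∉ C.Spar) : C.newLoop τ t = C.baseLoop t := by
  rw [newLoop, baseLoop_eq, C.newChart_of_not_mem τ]
  intro h; exact ht (C.mem_Spar_iff.2 (Ioo_subset_Icc_self h))

/-- On the window the displaced loops are the lifted mushroom. [folklore] -/
theorem newLoop_of_mem (τ : ℝ) {t : ℝ} (ht : t ∈ C.Spar) :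
    C.newLoop τ t = ((C.toSphere (mush C.lam τ (C.σ (2 * π * t))) : 𝕊 3) : 𝔼 4) := by
  rw [newLoop, C.newChart_of_mem τ (C.mem_Spar_iff.1 ht)]; rfl

/-- The base loop is injective on the fundamental domain. [folklore] -/
theorem injOn_baseLoop : InjOn C.baseLoop (Ico C.a₀ (C.a₀ + 1)) := by
  intro s hs t ht h
  rw [baseLoop_apply, baseLoop_apply, Subtype.coe_inj] at h
  have h1 := C.K.injective h
  obtain ⟨k, hk⟩ := exists_sub_eq_int_of_circlePoint_eq h1
  exact (eq_of_mem_Ico_of_sub_eq_int hs ht hk).symm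

/-- **The displaced loops are injective on the window.** [folklore] -/
theorem injOn_newLoop (τ : ℝ) : InjOn (C.newLoop τ) C.Spar := by
  intro s hs t ht h
  rw [C.newLoop_of_mem τ hs, C.newLoop_of_mem τ ht, Subtype.coe_inj, C.toSphere_injective.eq_iff] at h
  have h1 := mush_injective C.lam_pos τ h
  have h2 := C.strictMonoOn_σ.injOn (C.mem_Spar_iff.1 hs) (C.mem_Spar_iff.1 ht) h1
  have := mul_left_cancel₀ (by positivity : (2 * π : ℝ) ≠ 0) h2
  exact this

/-- **The displaced arc misses the rest of the knot**: for `s` in the window and `t` in the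
fundamental domain outside the window, `newLoop τ s ≠ baseLoop t`. [folklore] -/
theorem newLoop_ne_baseLoop (τ : ℝ) {s t : ℝ} (hs : s ∈ C.Spar) (ht : t ∈ Ico C.a₀ (C.a₀ + 1))
    (hts : t ∉ C.Spar) : C.newLoop τ s ≠ C.baseLoop t := by
  intro h
  rw [C.newLoop_of_mem τ hs, baseLoop_apply, Subtype.coe_inj] at h
  set u := C.σ (2 * π * s) with hu
  have hsw := C.mem_Spar_iff.1 hs
  by_cases hbig : 3 * C.lam / 4 ≤ |u|
  · -- the point did not move: it is the original segment point of parameter `s`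
    rw [mush_of_le_abs C.lam_pos τ hbig, hu, ← C.apply_circlePoint_eq_toSphere hsw] at h
    obtain ⟨k, hk⟩ := exists_sub_eq_int_of_circlePoint_eq (C.K.injective h)
    have heq : t = s := eq_of_mem_Ico_of_sub_eq_int (C.Spar_subset_Ico hs) ht hk
    rw [heq] at hts
    exact hts hs
  · -- the point lies in the clean box, so `K (2πt)` is a segment point of the window
    push Not at hbig
    have hq0 : |mush C.lam τ u 0| < C.ℓ := by
      have h1 := abs_mush_apply_zero_le C.lam_pos τ u
      have h2 : max |u| C.lam ≤ C.lam := max_le (by linarith [C.lam_pos]) le_rfl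
      linarith [C.lam_lt_ℓ]
    have hq1 : -C.ν < mush C.lam τ u 1 := by
      have := mush_apply_one_nonneg C.lam_pos τ u; linarith [C.ν_pos]
    have h' : C.K (circlePoint (2 * π * t)) = C.toSphere (mush C.lam τ u) := h.symm
    obtain ⟨-, θ', hθ', hx, -⟩ :=
      C.eq_of_apply_eq_toSphere (x := circlePoint (2 * π * t)) (q := mush C.lam τ u) hq0 hq1 h'
    have hx' : circlePoint (2 * π * t) = circlePoint (2 * π * (θ' / (2 * π))) := by
      rw [mul_div_cancel₀ _ (by positivity : (2 * π : ℝ) ≠ 0)]; exact hx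
    obtain ⟨k, hk⟩ := exists_sub_eq_int_of_circlePoint_eq hx'
    have hmem : θ' / (2 * π) ∈ C.Spar := C.div_mem_Spar hθ'
    have heq : θ' / (2 * π) = t := eq_of_mem_Ico_of_sub_eq_int ht (C.Spar_subset_Ico hmem) hk
    rw [heq] at hmem
    exact hts hmem

/-- The periodisation of the base loop is the base loop. [folklore] -/
theorem periodise_baseLoop : periodise C.a₀ C.baseLoop = C.baseLoop := by
  funext t
  obtain ⟨n, hn⟩ := exists_toIcoMod_one_eq C.a₀ t
  rw [periodise, hn]
  have h := C.periodic_baseLoop.sub_int_mul_eq n (x := t)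
  rwa [mul_one] at h

/-- The periodised base loop is a regular loop. [folklore] -/
theorem isRegularLoop_periodise_baseLoop : IsRegularLoop (periodise C.a₀ C.baseLoop) := by
  rw [periodise_baseLoop]; exact C.isRegularLoop_baseLoop

/-- The seam condition for the base loop. [folklore] -/
theorem seam_baseLoop : ∀ t ∈ Ioo (C.a₀ - C.ε₀) (C.a₀ + C.ε₀), C.baseLoop (t + 1) = C.baseLoop t :=
  fun t _ ↦ C.periodic_baseLoop t

/-- The periodised final displaced loop is a regular loop. [folklore] -/
theorem isRegularLoop_periodise_newLoop_one : IsRegularLoop (periodise C.a₀ (C.newLoop 1)) :=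
  C.isRegularLoop_periodise_baseLoop.periodise_of_eqOn_compl (C.contDiff_newLoop_stage 1) C.ε₀_pos
    C.seam_baseLoop C.Spar_subset isClosed_Icc (fun _ ht ↦ C.newLoop_of_not_mem 1 ht)
    (fun t _ ↦ C.norm_newLoop 1 t) (fun t _ ↦ C.deriv_newLoop_ne_zero 1 t)

/-- The final displaced loop is injective on the fundamental domain. [folklore] -/
theorem injOn_newLoop_one : InjOn (C.newLoop 1) (Ico C.a₀ (C.a₀ + 1)) :=
  injOn_Ico_of_eqOn_compl C.injOn_baseLoop (fun _ ht ↦ C.newLoop_of_not_mem 1 ht)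
    (C.injOn_newLoop 1) (fun _ hs _ ht hts ↦ C.newLoop_ne_baseLoop 1 hs ht hts)

/-! ### The new knot -/

/-- **The band sum `K # O` as a knot**: the knot of the final displaced loop. [folklore] -/
def newKnot : Knot :=
  C.isRegularLoop_periodise_newLoop_one.toKnot (periodise_simple_iff.2 C.injOn_newLoop_one)

/-- The knot of the periodised base loop is `K`. [folklore] -/
theorem toKnot_baseLoop :
    C.isRegularLoop_periodise_baseLoop.toKnot (periodise_simple_iff.2 C.injOn_baseLoop) = C.K := by
  have key : ∀ θ, C.isRegularLoop_periodise_baseLoop.toKnot (periodise_simple_iff.2 C.injOn_baseLoop)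
      (circlePoint θ) = C.K (circlePoint θ) := by
    intro θ
    apply Subtype.ext
    rw [IsRegularLoop.coe_toKnot_circlePoint, periodise_baseLoop, baseLoop_apply, ← mul_assoc,
      mul_inv_cancel₀ (by positivity : (2 * π : ℝ) ≠ 0), one_mul]
  apply SphereEmbedding.ext
  funext x
  obtain ⟨θ, rfl⟩ := circlePoint_surjective x
  exact key θ

/-- **`K` is isotopic to the band sum `K # O`** (the displaced loops `τ ∈ [0, 1]` form a smooth
family of simple regular loops; isotopy extension, Hirsch (1976), Ch. 8 §1, Thm. 1.3, through
`IsRegularLoop.isIsotopic_of_modification`). [cite: HirschDT1976, Ch. 8 §1, Thm. 1.3] -/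
theorem isIsotopic_newKnot : C.K.IsIsotopic C.newKnot := by
  have h := IsRegularLoop.isIsotopic_of_modification (G := C.newLoop) (S := C.Spar)
    C.isRegularLoop_periodise_baseLoop C.injOn_baseLoop C.isRegularLoop_periodise_newLoop_one
    C.injOn_newLoop_one C.ε₀_pos C.seam_baseLoop C.contDiff_newLoop C.Spar_subset isClosed_Icc
    (fun τ _ ht ↦ C.newLoop_of_not_mem τ ht) C.newLoop_zero (fun τ _ t _ ↦ C.norm_newLoop τ t)
    (fun τ _ t _ ↦ C.deriv_newLoop_ne_zero τ t) (fun τ _ ↦ C.injOn_newLoop τ)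
    (fun τ _ _ hs _ ht hts ↦ C.newLoop_ne_baseLoop τ hs ht hts)
  rw [toKnot_baseLoop] at h
  exact h

/-- Values of the new knot on the fundamental domain: `newKnot (cos θ, sin θ) = ψ⁻¹ (newChart 1 θ)`
when `θ / 2π ∈ [a₀, a₀ + 1)`. [folklore] -/
theorem newKnot_circlePoint_of_mem_Ico {θ : ℝ} (hθ : θ / (2 * π) ∈ Ico C.a₀ (C.a₀ + 1)) :
    C.newKnot (circlePoint θ) = psi.symm (C.newChart 1 θ) := by
  apply Subtype.ext
  rw [newKnot, IsRegularLoop.coe_toKnot_circlePoint, show (2 * π)⁻¹ * θ = θ / (2 * π) by ring,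
    periodise_eq_self C.a₀ _ hθ, newLoop, mul_div_cancel₀ _ (by positivity : (2 * π : ℝ) ≠ 0)]
  rfl

/-- **Values of the new knot on the window**: `newKnot (cos θ, sin θ) = toSphere (mush λ 1 (σ θ))`
for `θ ∈ [α, β]`. [folklore] -/
theorem newKnot_circlePoint_of_mem {θ : ℝ} (hθ : θ ∈ Icc C.α C.β) :
    C.newKnot (circlePoint θ) = C.toSphere (mush C.lam 1 (C.σ θ)) := by
  rw [C.newKnot_circlePoint_of_mem_Ico (C.Spar_subset_Ico (C.div_mem_Spar hθ)), C.newChart_of_mem 1 hθ]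
  rfl

/-- **Off the window the new knot is the old knot**: every point of the circle is either a window
point `(cos θ, sin θ)`, `θ ∈ [α, β]`, or a point where `newKnot` and `K` agree. [folklore] -/
theorem newKnot_eq_or (x : 𝕊 1) : (∃ θ ∈ Icc C.α C.β, x = circlePoint θ) ∨ C.newKnot x = C.K x := by
  obtain ⟨θ, rfl⟩ := circlePoint_surjective x
  -- the representative of `θ / 2π` in the fundamental domain
  obtain ⟨n, hn⟩ := exists_toIcoMod_one_eq C.a₀ (θ / (2 * π))
  have hmem : θ / (2 * π) - n ∈ Ico C.a₀ (C.a₀ + 1) := by rw [← hn]; exact toIcoMod_one_mem _ _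
  set θ₀ : ℝ := 2 * π * (θ / (2 * π) - n) with hθ₀
  have hcp : circlePoint θ = circlePoint θ₀ := by
    rw [hθ₀, mul_sub, mul_div_cancel₀ _ (by positivity : (2 * π : ℝ) ≠ 0),
      show θ - 2 * π * n = θ + (-n : ℤ) * (2 * π) by push_cast; ring]
    exact (periodic_circlePoint.int_mul (-n) θ).symm
  have hθ₀' : θ₀ / (2 * π) ∈ Ico C.a₀ (C.a₀ + 1) := by
    rw [hθ₀, mul_div_cancel_left₀ _ (by positivity : (2 * π : ℝ) ≠ 0)]; exact hmem
  by_cases h : θ₀ ∈ Icc C.α C.β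
  · exact Or.inl ⟨θ₀, h, hcp⟩
  · right
    rw [hcp, C.newKnot_circlePoint_of_mem_Ico hθ₀', C.newChart_of_not_mem 1 fun h' ↦ h (Ioo_subset_Icc_self h'),
      Knot.psi_symm_chartCurve C.ne_southPole]

/-- **The range of the new knot**: the lifted mushroom over the window together with the old knot
off the window. [folklore] -/
theorem mem_range_newKnot_iff (y : 𝕊 3) : y ∈ range C.newKnot ↔
    (∃ θ ∈ Icc C.α C.β, y = C.toSphere (mush C.lam 1 (C.σ θ))) ∨
      ∃ x : 𝕊 1, (¬∃ θ ∈ Icc C.α C.β, x = circlePoint θ) ∧ y = C.K x := by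
  constructor
  · rintro ⟨x, rfl⟩
    by_cases hx : ∃ θ ∈ Icc C.α C.β, x = circlePoint θ
    · obtain ⟨θ, hθ, rfl⟩ := hx
      exact Or.inl ⟨θ, hθ, C.newKnot_circlePoint_of_mem hθ⟩
    · refine Or.inr ⟨x, hx, ?_⟩
      rcases C.newKnot_eq_or x with h | h
      · exact absurd h hx
      · exact h
  · rintro (⟨θ, hθ, rfl⟩ | ⟨x, hx, rfl⟩)
    · exact ⟨circlePoint θ, C.newKnot_circlePoint_of_mem hθ⟩
    · rcases C.newKnot_eq_or x with h | h
      · exact absurd h hx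
      · exact ⟨x, h⟩

/-- Window points of the old knot: `K (cos θ, sin θ) = toSphere (σ θ, 0)`; off-window points of the
old knot are not lifted plane points of the clean region `{|s| < ℓ, d > -ν}`. [folklore] -/
theorem not_window_of_apply_eq_toSphere {x : 𝕊 1} (hx : ¬∃ θ ∈ Icc C.α C.β, x = circlePoint θ)
    {q : 𝔼 2} (hq0 : |q 0| < C.ℓ) (hq1 : -C.ν < q 1) : C.K x ≠ C.toSphere q := by
  intro h
  obtain ⟨-, θ, hθ, hxθ, -⟩ := C.eq_of_apply_eq_toSphere hq0 hq1 h
  exact hx ⟨θ, hθ, hxθ⟩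

end FlatArcConfig

end BandSumUnit

end Literature.Topology.FourManifolds
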